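import Summits.CriticalPhenomena.SAWScalingLimit.Theorems.SAWLoopFugacityFlowIsingBoundaryRatioForgettingDefs
import Summits.CriticalPhenomena.SAWScalingLimit.Theorems.SAWLoopFugacityFlowIsingBoundaryRatioWindowRectSucc
import Mathlib.Topology.MetricSpace.Thickening
import Mathlib.Topology.UniformSpace.HeineCantor
import HarnessLib

/-!
# Lattice shadows of chart paths in the bulk
(line `fk-anchor-transfer`, crux `IsingBoundaryRatio`, stmt-CriticalPhenomena-10650; helper file of the stub
`windowRectPresentation_holds : WindowRectPresentation`)

**Theorem** (`eventually_shadow`). Let `φ : ℍ → D` be a conformal chart of a Jordan domain and `K ⊂ ℍ` compact.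
For every accuracy `κ > 0` and all small mesh `δ`: (i) the closed `2δ`-balls about the points of `φ(K)` lie in
`D`; (ii) for any two lattice sites `z, z'` with mesh points in `D` and any path `γ` in `K` from the chart point
of `z` to the chart point of `z'`, there is a walk of the mesh graph of `D` from `z` to `z'` all of whose sites
have mesh points in `D` and chart points within `κ` of `γ`.

Construction: sample `γ` so finely that consecutive images `φ(γ tᵢ)` are `δ`-close (uniform continuity), round
each to the nearest site, and join consecutive sites (three lattice units apart at most) by monotone lattice
walks inside the `6δ`-ball about `φ(γ tᵢ)`, a convex subset of `D` when `6δ` is below the distance from the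
compact `φ(K)` to `∂D`; the chart error is the uniform continuity of `φ⁻¹` on a compact thickening of `φ(K)`.
[folklore]
-/

noncomputable section

open scoped Classical Topology
open Filter Set Metric Complex
open Literature.Probability.LatticeModels Literature.Probability.RandomPlanarGeometry
open Literature.Probability.LatticeModels.DiscreteRect
open UpperHalfPlane (upperHalfPlaneSet)

namespace Summit.CriticalPhenomena.SAWScalingLimit.Theorems.IsingBoundaryRatio

namespace WindowRect

/-! ### Monotone lattice walks inside a convex set -/

/-- Mesh points of lattice neighbours: `meshPoint δ (x + e_k) = meshPoint δ x + δ e_k`, so they are `δ` apart.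
[folklore] -/
theorem dist_meshPoint_add_dir {δ : ℝ} (hδ : 0 < δ) (x : Site 2) (k : Fin 4) :
    dist (meshPoint δ x) (meshPoint δ (x + dir k)) = δ := by
  rw [Complex.dist_eq, Complex.norm_eq_sqrt_sq_add_sq, Complex.sub_re, Complex.sub_im, meshPoint_re, meshPoint_re,
    meshPoint_im, meshPoint_im]
  have : (δ * (x 0 : ℝ) - δ * ((x + dir k) 0 : ℤ)) ^ 2 + (δ * (x 1 : ℝ) - δ * ((x + dir k) 1 : ℤ)) ^ 2 = δ ^ 2 := by
    simp only [Pi.add_apply]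
    rcases dir_apply_cases k with ⟨h0, h1⟩ | ⟨h0, h1⟩ | ⟨h0, h1⟩ | ⟨h0, h1⟩ <;> rw [h0, h1] <;> push_cast <;> ring
  rw [this, Real.sqrt_sq hδ.le]

/-- **Monotone lattice walks.** If every site of the coordinate box spanned by `a` and `b` has its mesh point in
a convex set `U ⊆ closure Ω`... `U` with `U ⊆ Ω`-closure controlled: precisely, if `U` is convex, contains the
mesh points of all sites of the box, and `U ⊆ closure Ω`, then `a` and `b` are joined by a walk of the mesh
graph of `Ω` through sites of the box. [folklore] -/
theorem exists_boxWalk {Ω U : Set ℂ} {δ : ℝ} (hU : Convex ℝ U) (hUΩ : U ⊆ closure Ω) :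
    ∀ (n : ℕ) (a b : Site 2), (b 0 - a 0).natAbs + (b 1 - a 1).natAbs = n →
      (∀ u : Site 2, min (a 0) (b 0) ≤ u 0 → u 0 ≤ max (a 0) (b 0) → min (a 1) (b 1) ≤ u 1 → u 1 ≤ max (a 1) (b 1) →
        meshPoint δ u ∈ U) →
      ∃ W : (meshGraph Ω δ).Walk a b, ∀ s ∈ W.support,
        min (a 0) (b 0) ≤ s 0 ∧ s 0 ≤ max (a 0) (b 0) ∧ min (a 1) (b 1) ≤ s 1 ∧ s 1 ≤ max (a 1) (b 1) := by
  intro n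
  induction n with
  | zero =>
    intro a b hn _
    have hab : a = b := by rw [Site.eq_iff_two]; omega
    subst hab
    exact ⟨SimpleGraph.Walk.nil, fun s hs => by
      rw [SimpleGraph.Walk.support_nil, List.mem_singleton] at hs; subst hs; simp⟩
  | succ n ih =>
    intro a b hn hbox
    -- one step towards `b`
    obtain ⟨k, hk⟩ : ∃ k : Fin 4,
        ((b 0 - (a + dir k) 0).natAbs + (b 1 - (a + dir k) 1).natAbs = n) ∧
        min (a 0) (b 0) ≤ (a + dir k) 0 ∧ (a + dir k) 0 ≤ max (a 0) (b 0) ∧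
        min (a 1) (b 1) ≤ (a + dir k) 1 ∧ (a + dir k) 1 ≤ max (a 1) (b 1) := by
      have e0 : dir 0 0 = 1 ∧ dir 0 1 = 0 := by decide
      have e1 : dir 1 0 = 0 ∧ dir 1 1 = 1 := by decide
      have e2 : dir 2 0 = -1 ∧ dir 2 1 = 0 := by decide
      have e3 : dir 3 0 = 0 ∧ dir 3 1 = -1 := by decide
      rcases lt_trichotomy (a 0) (b 0) with h0 | h0 | h0
      · refine ⟨0, ?_⟩; simp only [Pi.add_apply, e0.1, e0.2]; omega
      · rcases lt_trichotomy (a 1) (b 1) with h1 | h1 | h1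
        · refine ⟨1, ?_⟩; simp only [Pi.add_apply, e1.1, e1.2]; omega
        · exfalso; omega
        · refine ⟨3, ?_⟩; simp only [Pi.add_apply, e3.1, e3.2]; omega
      · refine ⟨2, ?_⟩; simp only [Pi.add_apply, e2.1, e2.2]; omega
    obtain ⟨hk, c0, c0', c1, c1'⟩ := hk
    have hbox' : ∀ u : Site 2, min ((a + dir k) 0) (b 0) ≤ u 0 → u 0 ≤ max ((a + dir k) 0) (b 0) →
        min ((a + dir k) 1) (b 1) ≤ u 1 → u 1 ≤ max ((a + dir k) 1) (b 1) → meshPoint δ u ∈ U := by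
      intro u h1 h2 h3 h4
      apply hbox <;> omega
    obtain ⟨W, hW⟩ := ih (a + dir k) b hk hbox'
    have ha : meshPoint δ a ∈ U := hbox a (min_le_left _ _) (le_max_left _ _) (min_le_left _ _) (le_max_left _ _)
    have ha' : meshPoint δ (a + dir k) ∈ U := hbox _ c0 c0' c1 c1'
    have hadj : (meshGraph Ω δ).Adj a (a + dir k) := by
      refine meshGraph_adj_iff.2 ⟨?_, (hU.segment_subset ha ha').trans hUΩ⟩
      rw [Literature.Probability.Percolation.zdGraph_two_adj_iff]
      simp only [Pi.add_apply]
      fin_cases k <;> simp [dir]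
    refine ⟨SimpleGraph.Walk.cons hadj W, fun s hs => ?_⟩
    rw [SimpleGraph.Walk.support_cons, List.mem_cons] at hs
    rcases hs with rfl | hs
    · exact ⟨min_le_left _ _, le_max_left _ _, min_le_left _ _, le_max_left _ _⟩
    · obtain ⟨h1, h2, h3, h4⟩ := hW s hs
      exact ⟨by omega, by omega, by omega, by omega⟩

/-- Sites of the coordinate box of two sites whose mesh points are within `δ` of two points `p, q` at distance
`≤ δ` have mesh points within `6δ` of `p`. [folklore] -/
theorem dist_lt_of_mem_box {δ : ℝ} (hδ : 0 < δ) {a b u : Site 2} {p q : ℂ} (ha : dist (meshPoint δ a) p ≤ δ)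
    (hb : dist (meshPoint δ b) q ≤ δ) (hpq : dist p q ≤ δ)
    (h0 : min (a 0) (b 0) ≤ u 0) (h0' : u 0 ≤ max (a 0) (b 0)) (h1 : min (a 1) (b 1) ≤ u 1) (h1' : u 1 ≤ max (a 1) (b 1)) :
    dist (meshPoint δ u) p < 6 * δ := by
  -- coordinates of `a` and `b` differ by at most `3`
  have hab : dist (meshPoint δ a) (meshPoint δ b) ≤ 3 * δ := by
    linarith [dist_triangle (meshPoint δ a) p q, dist_triangle (meshPoint δ a) q (meshPoint δ b), dist_comm (meshPoint δ b) q]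
  rw [Complex.dist_eq] at hab
  have hre := (abs_re_le_norm _).trans hab
  have him := (abs_im_le_norm _).trans hab
  rw [Complex.sub_re, meshPoint_re, meshPoint_re, ← mul_sub, abs_mul, abs_of_pos hδ] at hre
  rw [Complex.sub_im, meshPoint_im, meshPoint_im, ← mul_sub, abs_mul, abs_of_pos hδ] at him
  have hre' : |((a 0 : ℤ) : ℝ) - b 0| ≤ 3 := le_of_mul_le_mul_left (by linarith) hδ
  have him' : |((a 1 : ℤ) : ℝ) - b 1| ≤ 3 := le_of_mul_le_mul_left (by linarith) hδ
  rw [abs_le] at hre' him'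
  -- `u` is within `3δ` of `a` in each coordinate
  have hu0 : |δ * (u 0 : ℝ) - δ * a 0| ≤ 3 * δ := by
    rw [← mul_sub, abs_mul, abs_of_pos hδ, mul_comm]
    refine mul_le_mul_of_nonneg_right ?_ hδ.le
    have i1 : (min (a 0) (b 0) : ℝ) ≤ u 0 := by exact_mod_cast h0
    have i2 : (u 0 : ℝ) ≤ max (a 0) (b 0) := by exact_mod_cast h0'
    rw [abs_le]; constructor
    · rcases le_total (a 0 : ℝ) (b 0) with h | h
      · rw [min_eq_left h] at i1; linarith
      · rw [min_eq_right h] at i1; linarith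
    · push_cast at i2; rcases le_total (a 0 : ℝ) (b 0) with h | h
      · rw [max_eq_right h] at i2; linarith
      · rw [max_eq_left h] at i2; linarith
  have hu1 : |δ * (u 1 : ℝ) - δ * a 1| ≤ 3 * δ := by
    rw [← mul_sub, abs_mul, abs_of_pos hδ, mul_comm]
    refine mul_le_mul_of_nonneg_right ?_ hδ.le
    have i1 : (min (a 1) (b 1) : ℝ) ≤ u 1 := by exact_mod_cast h1
    have i2 : (u 1 : ℝ) ≤ max (a 1) (b 1) := by exact_mod_cast h1'
    rw [abs_le]; constructor
    · rcases le_total (a 1 : ℝ) (b 1) with h | h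
      · rw [min_eq_left h] at i1; linarith
      · rw [min_eq_right h] at i1; linarith
    · push_cast at i2; rcases le_total (a 1 : ℝ) (b 1) with h | h
      · rw [max_eq_right h] at i2; linarith
      · rw [max_eq_left h] at i2; linarith
  have hua : dist (meshPoint δ u) (meshPoint δ a) ≤ 3 * δ + 3 * δ := by
    rw [Complex.dist_eq]
    refine (Complex.norm_le_abs_re_add_abs_im _).trans ?_
    rw [Complex.sub_re, Complex.sub_im, meshPoint_re, meshPoint_re, meshPoint_im, meshPoint_im]
    exact add_le_add hu0 hu1
  -- but in fact `√(3²+3²) δ < 5δ`; the crude bound `6δ + δ` is not enough, so use the Euclidean bound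
  have hua' : dist (meshPoint δ u) (meshPoint δ a) < 5 * δ := by
    rw [Complex.dist_eq, ← Real.sqrt_sq (norm_nonneg _), ← Complex.normSq_eq_norm_sq, Complex.normSq_apply,
      show (5 : ℝ) * δ = Real.sqrt ((5 * δ) ^ 2) by rw [Real.sqrt_sq (by positivity)]]
    apply Real.sqrt_lt_sqrt (by nlinarith)
    rw [Complex.sub_re, Complex.sub_im, meshPoint_re, meshPoint_re, meshPoint_im, meshPoint_im]
    have h0 := abs_le.1 hu0
    have h1 := abs_le.1 hu1
    nlinarith
  linarith [dist_triangle (meshPoint δ u) (meshPoint δ a) p]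

/-! ### The shadow theorem -/

/-- **Lattice shadows of chart paths in the bulk.** See the module docstring. [folklore] -/
theorem eventually_shadow (D : JordanDomain) (φ : ConformalEquiv upperHalfPlaneSet D.carrier) {K : Set ℂ}
    (hK : IsCompact K) (hKH : K ⊆ upperHalfPlaneSet) {κ : ℝ} (hκ : 0 < κ) :
    ∀ᶠ δ in 𝓝[>] (0 : ℝ), (∀ w ∈ K, closedBall (φ w) (2 * δ) ⊆ D.carrier) ∧
      ∀ (z z' : Site 2), meshPoint δ z ∈ D.carrier → meshPoint δ z' ∈ D.carrier →
        ∀ γ : Path (φ.symm (meshPoint δ z)) (φ.symm (meshPoint δ z')), (∀ t, γ t ∈ K) →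
        ∃ W : (meshGraph D.carrier δ).Walk z z', ∀ s ∈ W.support, meshPoint δ s ∈ D.carrier ∧
          ∃ t, dist (φ.symm (meshPoint δ s)) (γ t) ≤ κ := by
  -- the compact image and a compact thickening of it inside `D`
  set KD : Set ℂ := φ '' K with hKD
  have hKDc : IsCompact KD := hK.image_of_continuousOn (φ.continuousOn.mono hKH)
  have hKDsub : KD ⊆ D.carrier := by
    rintro _ ⟨w, hw, rfl⟩; exact φ.mapsTo (hKH hw)
  obtain ⟨ϱ, hϱ, hϱD⟩ := hKDc.exists_cthickening_subset_open D.isOpen hKDsub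
  set C : Set ℂ := cthickening ϱ KD with hC
  have hCc : IsCompact C := hKDc.cthickening
  have hUC := hCc.uniformContinuousOn_of_continuous (φ.symm.continuousOn.mono hϱD)
  obtain ⟨τ, hτ, hτU⟩ := Metric.uniformContinuousOn_iff.1 hUC κ hκ
  have hδ₀ : 0 < min (ϱ / 8) (τ / 8) := by positivity
  filter_upwards [Ioo_mem_nhdsGT hδ₀] with δ hδ
  obtain ⟨hδ0, hδlt⟩ := hδ
  have hδϱ : 8 * δ < ϱ := by linarith [(lt_min_iff.1 hδlt).1]
  have hδτ : 8 * δ < τ := by linarith [(lt_min_iff.1 hδlt).2]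
  have hballC : ∀ p ∈ KD, ball p (6 * δ) ⊆ C := fun p hp =>
    (ball_subset_closedBall.trans (closedBall_subset_cthickening hp _)).trans (cthickening_mono (by linarith) _)
  refine ⟨fun w hw => ?_, fun z z' hz hz' γ hγ => ?_⟩
  · exact ((closedBall_subset_cthickening (mem_image_of_mem _ hw) _).trans (cthickening_mono (by linarith) _)).trans hϱD
  -- sampling the path
  have hγH : ∀ t, γ t ∈ upperHalfPlaneSet := fun t => hKH (hγ t)
  have hcont : Continuous fun t : unitInterval => (φ : ℂ → ℂ) (γ t) :=
    φ.continuousOn.comp_continuous γ.continuous hγH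
  obtain ⟨η, hη, hηU⟩ := Metric.uniformContinuous_iff.1 (CompactSpace.uniformContinuous_of_continuous hcont) δ hδ0
  obtain ⟨N, hN⟩ := exists_nat_gt (1 / η)
  have hNpos : (0 : ℝ) < N := (one_div_pos.2 hη).trans hN
  have hNη : 1 / (N : ℝ) < η := by rwa [one_div_lt hNpos hη]
  -- parameters `tᵢ = min (i/N) 1`
  set tt : ℕ → unitInterval := fun i => ⟨min ((i : ℝ) / N) 1, le_min (by positivity) zero_le_one, min_le_right _ _⟩ with htt
  have htt_dist : ∀ i, dist (tt i) (tt (i + 1)) < η := by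
    intro i
    refine lt_of_le_of_lt ?_ hNη
    show |min ((i : ℝ) / N) 1 - min (((i + 1 : ℕ) : ℝ) / N) 1| ≤ 1 / N
    have h1 : ((i : ℝ) / N) ≤ ((i + 1 : ℕ) : ℝ) / N := by
      apply div_le_div_of_nonneg_right _ hNpos.le; push_cast; linarith
    have h2 : (((i + 1 : ℕ) : ℝ) / N) = (i : ℝ) / N + 1 / N := by push_cast; ring
    rw [abs_sub_comm, abs_of_nonneg (sub_nonneg.2 (min_le_min_right 1 h1))]
    rcases le_total ((i : ℝ) / N) 1 with h | h
    · rw [min_eq_left h]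
      have := min_le_left (((i + 1 : ℕ) : ℝ) / N) 1
      linarith
    · rw [min_eq_right h, min_eq_right (h.trans h1)]
      have : (0 : ℝ) ≤ 1 / N := by positivity
      linarith
  have htt0 : tt 0 = 0 := Subtype.ext (by simp [htt])
  have httN : tt N = 1 := Subtype.ext (by simp [htt, div_self hNpos.ne'])
  -- the sample points and sites
  set p : ℕ → ℂ := fun i => φ (γ (tt i)) with hp
  set s : ℕ → Site 2 := fun i => nearestSite δ (p i) with hs
  have hpKD : ∀ i, p i ∈ KD := fun i => mem_image_of_mem _ (hγ _)
  have hps : ∀ i, dist (meshPoint δ (s i)) (p i) ≤ δ := fun i => dist_meshPoint_nearestSite_le hδ0 _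
  have hpp : ∀ i, dist (p i) (p (i + 1)) ≤ δ := fun i => (hηU (htt_dist i)).le
  have hsymm_p : ∀ i, φ.symm (p i) = γ (tt i) := fun i => φ.symm_apply_apply (hγH _)
  have hs0 : s 0 = z := by
    simp only [hs, hp, htt0]
    rw [γ.source, φ.apply_symm_apply hz, nearestSite_meshPoint hδ0.ne']
  have hsN : s N = z' := by
    simp only [hs, hp, httN]
    rw [γ.target, φ.apply_symm_apply hz', nearestSite_meshPoint hδ0.ne']
  -- one box walk
  have box : ∀ i, ∃ W : (meshGraph D.carrier δ).Walk (s i) (s (i + 1)), ∀ u ∈ W.support,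
      meshPoint δ u ∈ D.carrier ∧ ∃ t, dist (φ.symm (meshPoint δ u)) (γ t) ≤ κ := by
    intro i
    have hinU : ∀ u : Site 2, min (s i 0) (s (i + 1) 0) ≤ u 0 → u 0 ≤ max (s i 0) (s (i + 1) 0) →
        min (s i 1) (s (i + 1) 1) ≤ u 1 → u 1 ≤ max (s i 1) (s (i + 1) 1) → meshPoint δ u ∈ ball (p i) (6 * δ) :=
      fun u h0 h0' h1 h1' => mem_ball.2 (dist_lt_of_mem_box hδ0 (hps i) (hps (i + 1)) (hpp i) h0 h0' h1 h1')
    obtain ⟨W, hW⟩ := exists_boxWalk (Ω := D.carrier) (convex_ball (p i) (6 * δ))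
      (((hballC _ (hpKD i)).trans hϱD).trans subset_closure) _ (s i) (s (i + 1)) rfl hinU
    refine ⟨W, fun u hu => ?_⟩
    obtain ⟨h0, h0', h1, h1'⟩ := hW u hu
    have huB := hinU u h0 h0' h1 h1'
    have huC : meshPoint δ u ∈ C := hballC _ (hpKD i) huB
    refine ⟨hϱD huC, tt i, ?_⟩
    rw [← hsymm_p i]
    exact (hτU _ huC _ (hballC _ (hpKD i) (mem_ball_self (by positivity))) ((mem_ball.1 huB).trans (by linarith))).le
  -- concatenation
  have chain : ∀ n : ℕ, ∃ W : (meshGraph D.carrier δ).Walk (s 0) (s n), ∀ u ∈ W.support,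
      meshPoint δ u ∈ D.carrier ∧ ∃ t, dist (φ.symm (meshPoint δ u)) (γ t) ≤ κ := by
    intro n
    induction n with
    | zero =>
      refine ⟨SimpleGraph.Walk.nil, fun u hu => ?_⟩
      rw [SimpleGraph.Walk.support_nil, List.mem_singleton] at hu
      subst hu
      obtain ⟨W, hW⟩ := box 0
      exact hW _ (SimpleGraph.Walk.start_mem_support W)
    | succ n ih =>
      obtain ⟨W, hW⟩ := ih
      obtain ⟨W', hW'⟩ := box n
      refine ⟨W.append W', fun u hu => ?_⟩
      rw [SimpleGraph.Walk.mem_support_append_iff] at hu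
      exact hu.elim (hW u) (hW' u)
  obtain ⟨W, hW⟩ := chain N
  refine ⟨W.copy hs0 hsN, fun u hu => hW u ?_⟩
  rwa [SimpleGraph.Walk.support_copy] at hu

end WindowRect

/-- **Lattice shadows of chart paths in the bulk**, closed form (registered sub-goal of stmt-CriticalPhenomena-10650).
[folklore] -/
theorem windowRect_eventually_shadow : ∀ (D : Literature.Probability.RandomPlanarGeometry.JordanDomain) (φ : Literature.Probability.RandomPlanarGeometry.ConformalEquiv UpperHalfPlane.upperHalfPlaneSet D.carrier) {K : Set ℂ}, IsCompact K → K ⊆ UpperHalfPlane.upperHalfPlaneSet → ∀ {κ : ℝ}, 0 < κ → ∀ᶠ δ in nhdsWithin (0 : ℝ) (Set.Ioi 0), (∀ w ∈ K, Metric.closedBall (φ w) (2 * δ) ⊆ D.carrier) ∧ ∀ (z z' : Site 2), meshPoint δ z ∈ D.carrier → meshPoint δ z' ∈ D.carrier → ∀ γ : Path (φ.symm (meshPoint δ z)) (φ.symm (meshPoint δ z')), (∀ t, γ t ∈ K) → ∃ W : (meshGraph D.carrier δ).Walk z z', ∀ s ∈ W.support, meshPoint δ s ∈ D.carrier ∧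 ∃ t, dist (φ.symm (meshPoint δ s)) (γ t) ≤ κ :=
  fun D φ _ hK hKH _ hκ => WindowRect.eventually_shadow D φ hK hKH hκ

end Summit.CriticalPhenomena.SAWScalingLimit.Theorems.IsingBoundaryRatio

end
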